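import Literature.Computability.QuantumComplexity.QFTQubits
import Literature.Computability.QuantumComplexity.LetterWord
import HarnessLib

/-!
# The QFT over `ℤ_{2^κ}` on `κ` qubits, II: the round phases as two-qubit controlled phases

Topic `Literature/Computability/QuantumComplexity`, sequel of `QFTQubits.lean` (the ideal rounds
`roundMat ws j = phaseMat ws j * H_{ws j}` of the textbook QFT circuit and the theorem that their product
writes the Fourier state). A machine does not apply the diagonal `phaseMat ws j` in one go: it applies,
for `l = j + 1, …, κ − 1`, the **controlled phase** `R_{l-j+1}` between the wires `ws l` (control) and
`ws j` (Nielsen–Chuang 2010, Fig. 5.1), each realised over Clifford+`T` by a *phase gadget*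
(`PhaseGadgetAssemblyGen.phaseGadget_implOn_gen`: a Hadamard-sandwiched sign program with one round of
oblivious amplitude amplification implements `ctrlGate t (fun z => u z • 1)` — multiplication by a
label-dependent unit scalar — up to the dyadic rounding of `cos`, `sin` of the angle). This file
supplies the exact algebra in between:

* `QFTQubits.cphase ws j l` — the diagonal `|z⟩ ↦ e(1/2^{l-j+1})|z⟩` on `z_j = z_l = 1` (identity
  otherwise); unitary, support preserving;
* **`QFTQubits.prod_ofFn_cphase_eq_phaseMat`** — `Π_{l} cphase ws j l = phaseMat ws j` (the factors with
  `l ≤ j` are `1`; phases add: `eR_sum`);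
* `QFTQubits.cphase_eq_ctrlGate` — `cphase ws j l` is a phase-gadget target `ctrlGate t (fun z => u z • 1)`
  (by `ctrlGate_smul_one` of `LetterWord`; the gadget's side condition that the scalar does not read `t`
  is `cphaseDiag_update` for `t ∉ {ws j, ws l}`);
* `QFTQubits.roundGates ws j` — the round as a LIST of ideal gates (Hadamard, then the controlled phases),
  `prod_roundGates` (`= roundMat ws j`), and **`QFTQubits.prod_allGates_mulVec_basisState`**: the
  concatenation over the rounds maps `|x⟩` to the Fourier state;
* the robust form **`QFTQubits.l2Norm_prod_sub_fourierState_le`**: if every ideal gate of the list is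
  replaced by a contraction implementing it on a support condition `P` (closed under rewriting the wires
  `ws`, containing `x`) up to its error, the product applied to `|x⟩` is within the sum of the errors of
  the Fourier state (`ImplOn.listProd`).

Everything here is proved; definitions have bodies; no named fact is introduced.

## References

* M. A. Nielsen, I. L. Chuang, *Quantum Computation and Quantum Information*, CUP 2010, §5.1 Fig. 5.1,
  §4.3 (controlled operations), §4.5.3 eq. (4.63) [NielsenChuang2010].
* D. W. Berry, A. M. Childs, R. Cleve, R. Kothari, R. D. Somma, STOC 2014, Lemma 3.1 (the gadgets'
  oblivious amplitude amplification) [BerryEtAl2014].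
* O. Regev, *On lattices, learning with errors, random linear codes, and cryptography*, J. ACM 56
  (2009), art. 34, Lemma 3.14 (proof) [Regev2009].
-/

noncomputable section

namespace Literature.Computability.QuantumComplexity

open _root_.Matrix Complex Finset Cryptography

namespace QFTQubits

variable {N κ : ℕ} (ws : Fin κ ↪ Fin N)

/-! ### Phases of sums -/

/-- `e(Σ q_l) = Π e(q_l)`. [folklore] -/
theorem eR_sum {ι : Type*} (s : Finset ι) (q : ι → ℝ) : eR (∑ l ∈ s, q l) = ∏ l ∈ s, eR (q l) := by
  classical
  induction s using Finset.induction_on with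
  | empty => simp
  | insert a s ha ih => rw [sum_insert ha, prod_insert ha, eR_add, ih]

/-! ### Products of diagonal matrices -/

/-- A list of diagonal matrices multiplies to the diagonal of the pointwise products. [folklore] -/
theorem prod_map_diagonal (L : List (QReg N → ℂ)) :
    (L.map (Matrix.diagonal : (QReg N → ℂ) → Matrix (QReg N) (QReg N) ℂ)).prod = Matrix.diagonal fun z => (L.map fun d => d z).prod := by
  induction L with
  | nil => simp
  | cons d L ih =>
    rw [List.map_cons, List.prod_cons, ih, Matrix.diagonal_mul_diagonal]
    congr 1

/-! ### The two-qubit controlled phases -/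

/-- The diagonal entry of the controlled phase of round `j` from wire `ws l`: `e(1/2^{l-j+1})` if
`z_j = z_l = 1` and `j < l`, else `1`. [cite: NielsenChuang2010, §5.1 Fig. 5.1] -/
def cphaseDiag (j l : Fin κ) (z : QReg N) : ℂ :=
  if z (ws j) = true ∧ z (ws l) = true ∧ (j : ℕ) < l then eR (1 / (2 : ℝ) ^ ((l : ℕ) - j + 1)) else 1

/-- **The controlled phase of round `j` from wire `ws l`** (Nielsen–Chuang's `R_{l-j+1}` controlled by
qubit `l` on qubit `j`; symmetric in the two wires; the identity for `l ≤ j`). [cite: NielsenChuang2010, §5.1 Fig. 5.1] -/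
def cphase (j l : Fin κ) : Matrix (QReg N) (QReg N) ℂ := Matrix.diagonal (cphaseDiag ws j l)

/-- The diagonal entry as a phase: `e([z_j ∧ z_l ∧ j<l]/2^{l-j+1})`. [folklore] -/
theorem cphaseDiag_eq_eR (j l : Fin κ) (z : QReg N) :
    cphaseDiag ws j l z = eR (if z (ws j) = true ∧ z (ws l) = true ∧ (j : ℕ) < l then 1 / (2 : ℝ) ^ ((l : ℕ) - j + 1) else 0) := by
  unfold cphaseDiag; split_ifs <;> simp

/-- `|cphaseDiag| = 1` (the hypothesis `hu` of the phase gadget). [folklore] -/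
theorem norm_cphaseDiag (j l : Fin κ) (z : QReg N) : ‖cphaseDiag ws j l z‖ = 1 := by
  rw [cphaseDiag_eq_eR, norm_eR]

/-- `cphaseDiag` does not read wires off `ws j`, `ws l`. [folklore] -/
theorem cphaseDiag_update (j l : Fin κ) {t : Fin N} (htj : t ≠ ws j) (htl : t ≠ ws l) (z : QReg N) (b : Bool) :
    cphaseDiag ws j l (Function.update z t b) = cphaseDiag ws j l z := by
  unfold cphaseDiag
  rw [Function.update_of_ne (Ne.symm htj), Function.update_of_ne (Ne.symm htl)]

/-- **The controlled phases of round `j` multiply to its diagonal phase**: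
`(cphase ws j 0) ⋯ (cphase ws j (κ-1)) = phaseMat ws j`. [cite: NielsenChuang2010, §5.1 eq. (5.10)] -/
theorem prod_ofFn_cphase_eq_phaseMat (j : Fin κ) : (List.ofFn fun l : Fin κ => cphase ws j l).prod = phaseMat ws j := by
  unfold cphase phaseMat
  rw [show (List.ofFn fun l : Fin κ => Matrix.diagonal (cphaseDiag ws j l)) =
      (List.ofFn (cphaseDiag ws j)).map Matrix.diagonal by rw [List.map_ofFn]; rfl, prod_map_diagonal]
  congr 1; funext z
  rw [List.map_ofFn, List.prod_ofFn]
  simp_rw [Function.comp_def, cphaseDiag_eq_eR]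
  rw [← eR_sum]
  by_cases hz : z (ws j) = true
  · rw [if_pos hz]
    unfold phaseFrac
    congr 1
    refine sum_congr rfl fun l _ => ?_
    simp [hz]
  · rw [if_neg hz]
    rw [show (∑ l : Fin κ, (if z (ws j) = true ∧ z (ws l) = true ∧ (j : ℕ) < l then 1 / (2 : ℝ) ^ ((l : ℕ) - j + 1) else 0)) = 0 from
      sum_eq_zero fun l _ => if_neg fun h => hz h.1]
    exact eR_zero

/-- **`cphase` is unitary.** [folklore] -/
theorem cphase_mem_unitaryGroup (j l : Fin κ) : cphase ws j l ∈ Matrix.unitaryGroup (QReg N) ℂ := by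
  unfold cphase
  rw [Matrix.mem_unitaryGroup_iff, Matrix.star_eq_conjTranspose, Matrix.diagonal_conjTranspose, Matrix.diagonal_mul_diagonal,
    ← Matrix.diagonal_one]
  congr 1; funext z
  rw [Pi.star_apply, RCLike.star_def, Complex.mul_conj, Complex.normSq_eq_norm_sq, norm_cphaseDiag]
  simp

/-- `cphase` preserves every support condition. [folklore] -/
theorem preservesSupp_cphase (P : Set (QReg N)) (j l : Fin κ) : PreservesSupp P (cphase ws j l) :=
  preservesSupp_diagonal P _

/-! ### Diagonal unitaries as phase-gadget targets (`ctrlGate_smul_one` of `LetterWord`) -/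

/-- **`cphase` is a phase-gadget target**: `cphase ws j l = ctrlGate t (fun z => cphaseDiag ws j l z • 1)`
for any distinguished wire `t` (the gadget wants `t` off the two wires, `cphaseDiag_update`). [cite: NielsenChuang2010, §4.3] -/
theorem cphase_eq_ctrlGate (j l : Fin κ) (t : Fin N) :
    cphase ws j l = ctrlGate t (fun z => cphaseDiag ws j l z • (1 : Matrix (QReg 1) (QReg 1) ℂ)) := by
  rw [ctrlGate_smul_one]
  rfl

/-! ### The rounds as lists of ideal gates -/

/-- **The ideal gates of round `j`**, leftmost applied last: the controlled phases (any order — they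
commute; here increasing `l`), then — rightmost, applied first — the Hadamard on `ws j`. [cite: NielsenChuang2010, §5.1 Fig. 5.1] -/
def roundGates (j : Fin κ) : List (Matrix (QReg N) (QReg N) ℂ) :=
  (List.ofFn fun l : Fin κ => cphase ws j l) ++ [(hOn (ws j)).toMatrix 0]

/-- The round's gates multiply to the round. [cite: NielsenChuang2010, §5.1] -/
theorem prod_roundGates (j : Fin κ) : (roundGates ws j).prod = roundMat ws j := by
  unfold roundGates roundMat
  rw [List.prod_append, List.prod_singleton, prod_ofFn_cphase_eq_phaseMat]

/-- Every gate of a round is unitary. [folklore] -/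
theorem roundGates_mem_unitaryGroup (j : Fin κ) : ∀ M ∈ roundGates ws j, M ∈ Matrix.unitaryGroup (QReg N) ℂ := by
  intro M hM
  unfold roundGates at hM
  rw [List.mem_append, List.mem_ofFn, List.mem_singleton] at hM
  rcases hM with ⟨l, rfl⟩ | rfl
  · exact cphase_mem_unitaryGroup ws j l
  · exact QGate.toMatrix_mem_unitaryGroup_holds cliffordT_isUnitary_holds 0 (hOn (ws j))

/-- Every gate of a round preserves a support condition closed under rewriting `ws j`. [folklore] -/
theorem preservesSupp_roundGates {P : Set (QReg N)} (j : Fin κ) (hP : ∀ x b, Function.update x (ws j) b ∈ P ↔ x ∈ P) :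
    ∀ M ∈ roundGates ws j, PreservesSupp P M := by
  intro M hM
  unfold roundGates at hM
  rw [List.mem_append, List.mem_ofFn, List.mem_singleton] at hM
  rcases hM with ⟨l, rfl⟩ | rfl
  · exact preservesSupp_cphase ws P j l
  · exact preservesSupp_hOn hP

/-- **All ideal gates of the circuit**, leftmost applied last (round `κ − 1` first in the list). [cite: NielsenChuang2010, §5.1 Fig. 5.1] -/
def allGates : List (Matrix (QReg N) (QReg N) ℂ) := ((List.ofFn fun j : Fin κ => roundGates ws j).reverse).flatten

/-- The gates multiply to the product of the rounds. [folklore] -/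
theorem prod_allGates : (allGates ws).prod = (roundList ws).prod := by
  unfold allGates roundList
  rw [List.prod_flatten, List.map_reverse, List.map_ofFn]
  have : (List.prod ∘ fun j : Fin κ => roundGates ws j) = fun j => roundMat ws j := funext fun j => prod_roundGates ws j
  rw [this]

/-- **The gate list maps `|x⟩` to the Fourier state.** [cite: NielsenChuang2010, §5.1 eqs. (5.4)–(5.10)] -/
theorem prod_allGates_mulVec_basisState (x : QReg N) : (allGates ws).prod *ᵥ basisState x = fourierState ws x := by
  rw [prod_allGates, prod_roundList_mulVec_basisState]

/-- Every ideal gate is unitary. [folklore] -/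
theorem allGates_mem_unitaryGroup : ∀ M ∈ allGates ws, M ∈ Matrix.unitaryGroup (QReg N) ℂ := by
  intro M hM
  unfold allGates at hM
  rw [List.mem_flatten] at hM
  obtain ⟨L, hL, hML⟩ := hM
  rw [List.mem_reverse, List.mem_ofFn] at hL
  obtain ⟨j, rfl⟩ := hL
  exact roundGates_mem_unitaryGroup ws j M hML

/-- Every ideal gate preserves a support condition closed under rewriting each of the wires `ws`. [folklore] -/
theorem preservesSupp_allGates {P : Set (QReg N)} (hP : ∀ (j : Fin κ) (x : QReg N) (b : Bool), Function.update x (ws j) b ∈ P ↔ x ∈ P) :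
    ∀ M ∈ allGates ws, PreservesSupp P M := by
  intro M hM
  unfold allGates at hM
  rw [List.mem_flatten] at hM
  obtain ⟨L, hL, hML⟩ := hM
  rw [List.mem_reverse, List.mem_ofFn] at hL
  obtain ⟨j, rfl⟩ := hL
  exact preservesSupp_roundGates ws j (hP j) M hML

/-! ### The robust form -/

/-- **The QFT circuit with approximate gates.** If the ideal gates (in order) are replaced by contractions
implementing them on a support condition `P` (closed under rewriting the wires `ws`, containing the input
`x`) up to the listed errors — exactly for the Hadamards and spectator-free phases, up to the dyadic
rounding for the phase gadgets — then the product applied to `|x⟩` is within the sum of the errors of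
the Fourier state. [cite: NielsenChuang2010, §4.5.3 eq. (4.63)] [cite: BerryEtAl2014, Lemma 3.1] -/
theorem l2Norm_prod_sub_fourierState_le {P : Set (QReg N)}
    (hP : ∀ (j : Fin κ) (x : QReg N) (b : Bool), Function.update x (ws j) b ∈ P ↔ x ∈ P)
    (L : List (ApproxStep N)) (hL : L.map ApproxStep.ideal = allGates ws)
    (himpl : ∀ s ∈ L, ImplOn P s.act s.ideal s.err) (hcontr : ∀ s ∈ L, IsContraction s.act) (herr : ∀ s ∈ L, 0 ≤ s.err)
    (x : QReg N) (hxP : x ∈ P) :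
    l2Norm ((L.map ApproxStep.act).prod *ᵥ basisState x - fourierState ws x) ≤ (L.map ApproxStep.err).sum := by
  have hgood : ∀ s ∈ L, s.Good P := by
    intro s hs
    have hideal : s.ideal ∈ allGates ws := by rw [← hL]; exact List.mem_map_of_mem hs
    exact ⟨himpl s hs, hcontr s hs, isContraction_of_mem_unitaryGroup (allGates_mem_unitaryGroup ws _ hideal),
      preservesSupp_allGates ws hP _ hideal, herr s hs⟩
  have h := ImplOn.listProd hgood (basisState x) (suppIn_basisState hxP)
  rw [hL, prod_allGates_mulVec_basisState] at h
  have hn : l2Norm (basisState x) = 1 := by rw [l2Norm_eq_sqrt_normSq, normSq_basisState, Real.sqrt_one]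
  rwa [hn, mul_one] at h

end QFTQubits

end Literature.Computability.QuantumComplexity

end
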